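import Mathlib.Data.ZMod.Basic
import Mathlib.Algebra.BigOperators.Fin
import HarnessLib

/-!
# Torus charts: coordinates and unit translations on finite products of cyclic groups

A **torus chart** with `d` directions on an additive abelian group `Λ` of sites (`TorusChart Λ d`) consists of
periods `N_i`, unit translations `e_i ∈ Λ` and canonical coordinates `cval i : Λ → {0, …, N_i - 1}` reading an
isomorphism `Λ ≅ ∏ᵢ ℤ/N_iℤ` which takes `e_i` to the `i`-th unit vector.  The point of the chart language is
that the discrete exterior calculus and the structure theorem for flat `1`-cochains
(`TorusChartCochains.lean`, `TorusChartFlatCochains.lean`) and the spin-wave lift of angle configurations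
(`TorusChartSpinWaveLift.lean`) are proved ONCE and apply verbatim to every concrete site type of the
lattice-model files — the isotropic torus `Fin d → ZMod L` (`TorusChart.pi`), the anisotropic space–time tori
`(Fin d → ZMod L) × ZMod M` (`TorusChart.piProdZMod`) and `ZMod L₀ × (Fin d → ZMod L)` (`TorusChart.zmodProdPi`),
and any other product (`TorusChart.prod`, `TorusChart.zmod`) — with no transport along equivalences.

## Contents (everything is proved)

* `TorusChart`; coordinates of translates (`cval_add_nsmul_gen`, `cval_add_sum_nsmul_gen`), periodicity
  `add_period_nsmul_gen : x + N_i • e_i = x`, `eq_sum_cval_nsmul_gen : x = Σ_i (cval i x) • e_i`, and the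
  bijection between sites and reduced coordinate tuples (`existsUnique_cval_eq`, `site`, `cval_site`).
* `trunc k x` — the corner of the lexicographic axial staircase from `0` to `x` after `k` directions
  (`trunc_zero`, `trunc_succ`, `trunc_of_le`, `trunc_add_gen_of_lt`).
* The charts `zmod N`, `pi d L`, `prod`, `piProdZMod d L M`, `zmodProdPi L₀ d L` with their `simp` lemmas.
-/

namespace Literature.MathematicalPhysics.QuantumFieldTheory

open scoped BigOperators

/-- A **torus chart** with `d` directions on an additive abelian group `Λ` of sites: periods `N_i`, unit
translations `e_i` and canonical coordinates `cval i : Λ → ℕ` with values in `{0, …, N_i - 1}`, such that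
`cval i 0 = 0`, a unit step in direction `i` raises the `i`-th coordinate by one modulo `N_i` and fixes the
others, and sites are determined by their coordinates — i.e. the coordinates read an isomorphism
`Λ ≅ ∏ᵢ ℤ/N_iℤ` taking `e_i` to the `i`-th unit vector. [folklore] -/
structure TorusChart (Λ : Type*) [AddCommGroup Λ] (d : ℕ) where
  /-- the periods `N_i` -/
  period : Fin d → ℕ
  /-- the unit translations `e_i` -/
  gen : Fin d → Λ
  /-- the canonical coordinates `x_i ∈ {0, …, N_i - 1}` -/
  cval : Fin d → Λ → ℕ
  /-- coordinates are reduced residues -/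
  cval_lt : ∀ i x, cval i x < period i
  /-- the origin has coordinates `0` -/
  cval_zero : ∀ i, cval i 0 = 0
  /-- a unit step in direction `i` raises the `i`-th coordinate by one, cyclically -/
  cval_add_gen_self : ∀ i x, cval i (x + gen i) = (cval i x + 1) % period i
  /-- a unit step in direction `j ≠ i` fixes the `i`-th coordinate -/
  cval_add_gen_of_ne : ∀ {i j : Fin d} (x : Λ), i ≠ j → cval i (x + gen j) = cval i x
  /-- sites are determined by their coordinates -/
  ext_cval : ∀ {x y : Λ}, (∀ i, cval i x = cval i y) → x = y

namespace TorusChart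

variable {Λ : Type*} [AddCommGroup Λ] {d : ℕ} (F : TorusChart Λ d)

/-! ## Coordinates of translates -/

/-- Every period is positive (the coordinate of any site is a residue below it). [folklore] -/
theorem period_pos (i : Fin d) : 0 < F.period i :=
  lt_of_le_of_lt (Nat.zero_le _) (F.cval_lt i 0)

/-- `NeZero` form of `period_pos`. [folklore] -/
theorem neZero_period (i : Fin d) : NeZero (F.period i) := ⟨(F.period_pos i).ne'⟩

/-- Coordinates along a straight line: `cval i (x + n • e_i) = (cval i x + n) mod N_i`. [folklore] -/
theorem cval_add_nsmul_gen_self (i : Fin d) (x : Λ) :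
    ∀ n : ℕ, F.cval i (x + n • F.gen i) = (F.cval i x + n) % F.period i
  | 0 => by simp [Nat.mod_eq_of_lt (F.cval_lt i x)]
  | n + 1 => by
    rw [succ_nsmul, ← add_assoc, F.cval_add_gen_self, cval_add_nsmul_gen_self i x n, Nat.mod_add_mod,
      add_assoc]

/-- Transverse coordinates are constant along a straight line. [folklore] -/
theorem cval_add_nsmul_gen_of_ne {i j : Fin d} (hij : i ≠ j) (x : Λ) :
    ∀ n : ℕ, F.cval i (x + n • F.gen j) = F.cval i x
  | 0 => by simp
  | n + 1 => by rw [succ_nsmul, ← add_assoc, F.cval_add_gen_of_ne _ hij, cval_add_nsmul_gen_of_ne hij x n]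

/-- Coordinates of a translate by a multiple of a unit translation, both cases at once. [folklore] -/
theorem cval_add_nsmul_gen (i j : Fin d) (x : Λ) (n : ℕ) :
    F.cval i (x + n • F.gen j) = if i = j then (F.cval i x + n) % F.period i else F.cval i x := by
  split_ifs with h
  · subst h; exact F.cval_add_nsmul_gen_self i x n
  · exact F.cval_add_nsmul_gen_of_ne h x n

/-- **Periodicity**: `N_i` steps in direction `i` return to the start. [folklore] -/
theorem add_period_nsmul_gen (i : Fin d) (x : Λ) : x + F.period i • F.gen i = x := by
  refine F.ext_cval fun j => ?_
  rw [cval_add_nsmul_gen]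
  split_ifs with h
  · subst h; simp [Nat.mod_eq_of_lt (F.cval_lt j x)]
  · rfl

/-- The unit translation `e_i` has finite additive order dividing `N_i`: `N_i • e_i = 0`. [folklore] -/
theorem period_nsmul_gen (i : Fin d) : F.period i • F.gen i = 0 := by
  simpa using F.add_period_nsmul_gen i 0

/-- Coordinates of a translate by a combination `Σ_{j ∈ s} n_j • e_j` of unit translations. [folklore] -/
theorem cval_add_sum_nsmul_gen (i : Fin d) (x : Λ) (n : Fin d → ℕ) (s : Finset (Fin d)) :
    F.cval i (x + ∑ j ∈ s, n j • F.gen j) =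
      if i ∈ s then (F.cval i x + n i) % F.period i else F.cval i x := by
  classical
  induction s using Finset.induction_on with
  | empty => simp
  | insert a s ha ih =>
    rw [Finset.sum_insert ha, add_left_comm, add_comm (n a • F.gen a), cval_add_nsmul_gen, ih]
    by_cases hia : i = a
    · subst hia
      simp [ha]
    · simp [hia]

/-- **Every site is the combination of the unit translations with its coordinates as coefficients**:
`x = Σ_i (cval i x) • e_i`. [folklore] -/
theorem eq_sum_cval_nsmul_gen (x : Λ) : x = ∑ i, F.cval i x • F.gen i := by
  refine F.ext_cval fun i => ?_
  have h := F.cval_add_sum_nsmul_gen i 0 (fun j => F.cval j x) Finset.univ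
  rw [zero_add] at h
  rw [h, if_pos (Finset.mem_univ i), F.cval_zero, zero_add, Nat.mod_eq_of_lt (F.cval_lt i x)]

/-- Coordinates of a combination of the unit translations with reduced coefficients. [folklore] -/
theorem cval_sum_nsmul_gen (n : Fin d → ℕ) (hn : ∀ j, n j < F.period j) (i : Fin d) :
    F.cval i (∑ j, n j • F.gen j) = n i := by
  have h := F.cval_add_sum_nsmul_gen i 0 n Finset.univ
  rw [zero_add] at h
  rw [h, if_pos (Finset.mem_univ i), F.cval_zero, zero_add, Nat.mod_eq_of_lt (hn i)]

/-- **Coordinates are a bijection onto the box** `∏ᵢ {0, …, N_i - 1}`: every reduced tuple is the coordinate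
tuple of exactly one site. [folklore] -/
theorem existsUnique_cval_eq (n : Fin d → ℕ) (hn : ∀ j, n j < F.period j) :
    ∃! x : Λ, ∀ i, F.cval i x = n i :=
  ⟨∑ j, n j • F.gen j, F.cval_sum_nsmul_gen n hn, fun _ hy =>
    F.ext_cval fun i => by rw [hy i, F.cval_sum_nsmul_gen n hn]⟩

/-- A non-wrapping unit step raises the coordinate by exactly one. [folklore] -/
theorem cval_add_gen_self_of_lt (i : Fin d) (x : Λ) (hx : F.cval i x + 1 < F.period i) :
    F.cval i (x + F.gen i) = F.cval i x + 1 := by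
  rw [F.cval_add_gen_self, Nat.mod_eq_of_lt hx]

/-- A wrapping unit step resets the coordinate to zero. [folklore] -/
theorem cval_add_gen_self_of_eq (i : Fin d) (x : Λ) (hx : F.cval i x + 1 = F.period i) :
    F.cval i (x + F.gen i) = 0 := by
  rw [F.cval_add_gen_self, hx, Nat.mod_self]

/-- The coordinate of `n • e_i` below the period is `n`. [folklore] -/
theorem cval_nsmul_gen_self_of_lt (i : Fin d) {n : ℕ} (hn : n < F.period i) : F.cval i (n • F.gen i) = n := by
  have h := F.cval_add_nsmul_gen_self i 0 n
  rwa [zero_add, F.cval_zero, zero_add, Nat.mod_eq_of_lt hn] at h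

/-- Transverse coordinates of `n • e_j` vanish. [folklore] -/
theorem cval_nsmul_gen_of_ne {i j : Fin d} (hij : i ≠ j) (n : ℕ) : F.cval i (n • F.gen j) = 0 := by
  have h := F.cval_add_nsmul_gen_of_ne hij 0 n
  rwa [zero_add, F.cval_zero] at h

/-! ## The axial staircase: truncated sites -/

/-- **Truncation** of a site: keep the coordinates of the directions `< k`, zero the others — the corner of the
lexicographic axial staircase from `0` to `x` after `k` directions. [folklore] -/
noncomputable def trunc (k : ℕ) (x : Λ) : Λ :=
  ∑ j ∈ Finset.univ.filter (fun j : Fin d => (j : ℕ) < k), F.cval j x • F.gen j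

/-- No direction kept: the corner is the origin. [folklore] -/
@[simp] theorem trunc_zero (x : Λ) : F.trunc 0 x = 0 := by
  simp [trunc]

/-- All directions kept: the corner is the site itself. [folklore] -/
theorem trunc_of_le {k : ℕ} (hk : d ≤ k) (x : Λ) : F.trunc k x = x := by
  rw [trunc, Finset.filter_true_of_mem fun j _ => lt_of_lt_of_le j.isLt hk]
  exact (F.eq_sum_cval_nsmul_gen x).symm

/-- One more direction: the corner moves by `x_k • e_k`. [folklore] -/
theorem trunc_succ {k : ℕ} (hk : k < d) (x : Λ) :
    F.trunc (k + 1) x = F.trunc k x + F.cval ⟨k, hk⟩ x • F.gen ⟨k, hk⟩ := by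
  have hsplit : Finset.univ.filter (fun j : Fin d => (j : ℕ) < k + 1) =
      insert ⟨k, hk⟩ (Finset.univ.filter (fun j : Fin d => (j : ℕ) < k)) := by
    ext j
    simp only [Finset.mem_filter, Finset.mem_univ, true_and, Finset.mem_insert, Fin.ext_iff]
    omega
  have hnot : (⟨k, hk⟩ : Fin d) ∉ Finset.univ.filter (fun j : Fin d => (j : ℕ) < k) := by simp
  rw [trunc, trunc, hsplit, Finset.sum_insert hnot, add_comm]

/-- Beyond `d` directions the corner no longer moves. [folklore] -/
theorem trunc_succ_of_le {k : ℕ} (hk : d ≤ k) (x : Λ) : F.trunc (k + 1) x = F.trunc k x := by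
  rw [F.trunc_of_le hk, F.trunc_of_le (Nat.le_succ_of_le hk)]

/-- Coordinates of a corner: the kept ones. [folklore] -/
theorem cval_trunc (k : ℕ) (x : Λ) (i : Fin d) :
    F.cval i (F.trunc k x) = if (i : ℕ) < k then F.cval i x else 0 := by
  have h := F.cval_add_sum_nsmul_gen i 0 (fun j => F.cval j x) (Finset.univ.filter fun j : Fin d => (j : ℕ) < k)
  rw [zero_add] at h
  rw [trunc, h]
  simp only [Finset.mem_filter, Finset.mem_univ, true_and, F.cval_zero, zero_add,
    Nat.mod_eq_of_lt (F.cval_lt i x)]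

/-- **Truncation of a non-wrapping translate**: the unit step survives iff its direction is already kept.
[folklore] -/
theorem trunc_add_gen_of_lt (k : ℕ) (x : Λ) (μ : Fin d) (hx : F.cval μ x + 1 < F.period μ) :
    F.trunc k (x + F.gen μ) = F.trunc k x + (if (μ : ℕ) < k then F.gen μ else 0) := by
  refine F.ext_cval fun i => ?_
  have hR : F.cval i (F.trunc k x + (if (μ : ℕ) < k then F.gen μ else 0)) =
      if (i : ℕ) < k then F.cval i (x + F.gen μ) else 0 := by
    split_ifs with hμ hi hi
    · by_cases hiμ : i = μ
      · subst hiμ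
        rw [F.cval_add_gen_self_of_lt _ _ hx, F.cval_add_gen_self, cval_trunc, if_pos hi, Nat.mod_eq_of_lt hx]
      · rw [F.cval_add_gen_of_ne _ hiμ, F.cval_add_gen_of_ne _ hiμ, cval_trunc, if_pos hi]
    · have hiμ : i ≠ μ := fun h => hi (h ▸ hμ)
      rw [F.cval_add_gen_of_ne _ hiμ, cval_trunc, if_neg hi]
    · have hiμ : i ≠ μ := fun h => hμ (h ▸ hi)
      rw [add_zero, cval_trunc, if_pos hi, F.cval_add_gen_of_ne _ hiμ]
    · rw [add_zero, cval_trunc, if_neg hi]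
  rw [hR, cval_trunc]

/-! ## Sites from coordinate tuples -/

/-- The site with a prescribed coordinate tuple: `site n = Σ_j n_j • e_j`. [folklore] -/
noncomputable def site (n : Fin d → ℕ) : Λ := ∑ j, n j • F.gen j

/-- Coordinates of `site n` for a reduced tuple `n`. [folklore] -/
theorem cval_site {n : Fin d → ℕ} (hn : ∀ j, n j < F.period j) (i : Fin d) : F.cval i (F.site n) = n i :=
  F.cval_sum_nsmul_gen n hn i

/-- Every site is the site of its coordinate tuple. [folklore] -/
theorem site_cval (x : Λ) : F.site (fun j => F.cval j x) = x := (F.eq_sum_cval_nsmul_gen x).symm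

/-! ## Charts on concrete tori -/

section Charts

/-- **The chart of a cyclic group** `ZMod N` (`N ≥ 1`): one direction, unit translation `1`, coordinate
`ZMod.val`. [folklore] -/
def zmod (N : ℕ) [NeZero N] : TorusChart (ZMod N) 1 where
  period := fun _ => N
  gen := fun _ => 1
  cval := fun _ x => x.val
  cval_lt := fun _ x => ZMod.val_lt x
  cval_zero := fun _ => ZMod.val_zero
  cval_add_gen_self := fun _ x => by rw [ZMod.val_add, ZMod.val_one_eq_one_mod, Nat.add_mod_mod]
  cval_add_gen_of_ne := fun {i j} _ hij => absurd (Subsingleton.elim i j) hij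
  ext_cval := fun {x y} h => ZMod.val_injective N (h 0)

/-- The period of the cyclic chart. [folklore] -/
@[simp] theorem zmod_period (N : ℕ) [NeZero N] (i : Fin 1) : (zmod N).period i = N := rfl

/-- The unit translation of the cyclic chart. [folklore] -/
@[simp] theorem zmod_gen (N : ℕ) [NeZero N] (i : Fin 1) : (zmod N).gen i = 1 := rfl

/-- The coordinate of the cyclic chart. [folklore] -/
@[simp] theorem zmod_cval (N : ℕ) [NeZero N] (i : Fin 1) (x : ZMod N) : (zmod N).cval i x = x.val := rfl

/-- **The isotropic chart** of the discrete torus `Fin d → ZMod L` (`L ≥ 1`; the site type `TorusSite d L` /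
`Site d L` of the lattice-model and lattice-gauge files): unit translations `Pi.single i 1`, coordinates
`(x i).val`. [folklore] -/
def pi (d L : ℕ) [NeZero L] : TorusChart (Fin d → ZMod L) d where
  period := fun _ => L
  gen := fun i => Pi.single i 1
  cval := fun i x => (x i).val
  cval_lt := fun i x => ZMod.val_lt _
  cval_zero := fun i => by simp
  cval_add_gen_self := fun i x => by
    rw [Pi.add_apply, Pi.single_eq_same, ZMod.val_add, ZMod.val_one_eq_one_mod, Nat.add_mod_mod]
  cval_add_gen_of_ne := fun {i j} x hij => by rw [Pi.add_apply, Pi.single_eq_of_ne hij, add_zero]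
  ext_cval := fun {x y} h => funext fun i => ZMod.val_injective L (h i)

/-- The periods of the isotropic chart. [folklore] -/
@[simp] theorem pi_period (d L : ℕ) [NeZero L] (i : Fin d) : (pi d L).period i = L := rfl

/-- The unit translations of the isotropic chart. [folklore] -/
@[simp] theorem pi_gen (d L : ℕ) [NeZero L] (i : Fin d) : (pi d L).gen i = Pi.single i 1 := rfl

/-- The coordinates of the isotropic chart. [folklore] -/
@[simp] theorem pi_cval (d L : ℕ) [NeZero L] (i : Fin d) (x : Fin d → ZMod L) : (pi d L).cval i x = (x i).val :=
  rfl

variable {Λ₁ Λ₂ : Type*} [AddCommGroup Λ₁] [AddCommGroup Λ₂] {d₁ d₂ : ℕ}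

/-- **Product chart**: the directions of `Λ₁` first, then those of `Λ₂` (`Fin.append`).  This yields the
anisotropic space–time tori `(Fin d → ZMod L) × ZMod M`, `ZMod L₀ × (Fin d → ZMod L)`, … [folklore] -/
def prod (F₁ : TorusChart Λ₁ d₁) (F₂ : TorusChart Λ₂ d₂) : TorusChart (Λ₁ × Λ₂) (d₁ + d₂) where
  period := Fin.append F₁.period F₂.period
  gen := Fin.append (fun i => (F₁.gen i, 0)) (fun j => (0, F₂.gen j))
  cval := Fin.append (fun i x => F₁.cval i x.1) (fun j x => F₂.cval j x.2)
  cval_lt := fun i x => by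
    induction i using Fin.addCases with
    | left i => simp only [Fin.append_left]; exact F₁.cval_lt i x.1
    | right j => simp only [Fin.append_right]; exact F₂.cval_lt j x.2
  cval_zero := fun i => by
    induction i using Fin.addCases with
    | left i => simp only [Fin.append_left]; exact F₁.cval_zero i
    | right j => simp only [Fin.append_right]; exact F₂.cval_zero j
  cval_add_gen_self := fun i x => by
    induction i using Fin.addCases with
    | left i => simp only [Fin.append_left, Prod.fst_add]; exact F₁.cval_add_gen_self i x.1
    | right j => simp only [Fin.append_right, Prod.snd_add]; exact F₂.cval_add_gen_self j x.2
  cval_add_gen_of_ne := fun {i j} x hij => by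
    induction i using Fin.addCases with
    | left i =>
      induction j using Fin.addCases with
      | left j =>
        have hij' : i ≠ j := fun h => hij (by rw [h])
        simp only [Fin.append_left, Prod.fst_add]
        exact F₁.cval_add_gen_of_ne x.1 hij'
      | right j => simp only [Fin.append_left, Fin.append_right, Prod.fst_add, add_zero]
    | right i =>
      induction j using Fin.addCases with
      | left j => simp only [Fin.append_left, Fin.append_right, Prod.snd_add, add_zero]
      | right j =>
        have hij' : i ≠ j := fun h => hij (by rw [h])
        simp only [Fin.append_right, Prod.snd_add]
        exact F₂.cval_add_gen_of_ne x.2 hij'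
  ext_cval := fun {x y} h => Prod.ext
    (F₁.ext_cval fun i => by simpa only [Fin.append_left] using h (Fin.castAdd d₂ i))
    (F₂.ext_cval fun j => by simpa only [Fin.append_right] using h (Fin.natAdd d₁ j))

/-- Periods of a product chart: first factor. [folklore] -/
@[simp] theorem prod_period_castAdd (F₁ : TorusChart Λ₁ d₁) (F₂ : TorusChart Λ₂ d₂) (i : Fin d₁) :
    (F₁.prod F₂).period (Fin.castAdd d₂ i) = F₁.period i := by simp [prod]

/-- Periods of a product chart: second factor. [folklore] -/
@[simp] theorem prod_period_natAdd (F₁ : TorusChart Λ₁ d₁) (F₂ : TorusChart Λ₂ d₂) (j : Fin d₂) :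
    (F₁.prod F₂).period (Fin.natAdd d₁ j) = F₂.period j := by simp [prod]

/-- Unit translations of a product chart: first factor. [folklore] -/
@[simp] theorem prod_gen_castAdd (F₁ : TorusChart Λ₁ d₁) (F₂ : TorusChart Λ₂ d₂) (i : Fin d₁) :
    (F₁.prod F₂).gen (Fin.castAdd d₂ i) = (F₁.gen i, 0) := by simp [prod]

/-- Unit translations of a product chart: second factor. [folklore] -/
@[simp] theorem prod_gen_natAdd (F₁ : TorusChart Λ₁ d₁) (F₂ : TorusChart Λ₂ d₂) (j : Fin d₂) :
    (F₁.prod F₂).gen (Fin.natAdd d₁ j) = (0, F₂.gen j) := by simp [prod]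

/-- Coordinates of a product chart: first factor. [folklore] -/
@[simp] theorem prod_cval_castAdd (F₁ : TorusChart Λ₁ d₁) (F₂ : TorusChart Λ₂ d₂) (i : Fin d₁) (x : Λ₁ × Λ₂) :
    (F₁.prod F₂).cval (Fin.castAdd d₂ i) x = F₁.cval i x.1 := by simp [prod]

/-- Coordinates of a product chart: second factor. [folklore] -/
@[simp] theorem prod_cval_natAdd (F₁ : TorusChart Λ₁ d₁) (F₂ : TorusChart Λ₂ d₂) (j : Fin d₂) (x : Λ₁ × Λ₂) :
    (F₁.prod F₂).cval (Fin.natAdd d₁ j) x = F₂.cval j x.2 := by simp [prod]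

/-- **The space–time chart** of `(Fin d → ZMod L) × ZMod M` (`d` spatial directions of period `L`, then one
temporal direction of period `M`; the site type `TorusSite d L × ZMod M` of anisotropic classical models and
Trotterised quantum models). [folklore] -/
def piProdZMod (d L M : ℕ) [NeZero L] [NeZero M] : TorusChart ((Fin d → ZMod L) × ZMod M) (d + 1) :=
  (pi d L).prod (zmod M)

/-- Spatial periods of the space–time chart. [folklore] -/
@[simp] theorem piProdZMod_period_castSucc (d L M : ℕ) [NeZero L] [NeZero M] (i : Fin d) :
    (piProdZMod d L M).period (Fin.castSucc i) = L :=
  prod_period_castAdd _ _ i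

/-- Temporal period of the space–time chart. [folklore] -/
@[simp] theorem piProdZMod_period_last (d L M : ℕ) [NeZero L] [NeZero M] :
    (piProdZMod d L M).period (Fin.last d) = M :=
  prod_period_natAdd (pi d L) (zmod M) 0

/-- Spatial unit translations of the space–time chart. [folklore] -/
@[simp] theorem piProdZMod_gen_castSucc (d L M : ℕ) [NeZero L] [NeZero M] (i : Fin d) :
    (piProdZMod d L M).gen (Fin.castSucc i) = (Pi.single i 1, 0) :=
  prod_gen_castAdd _ _ i

/-- Temporal unit translation of the space–time chart. [folklore] -/
@[simp] theorem piProdZMod_gen_last (d L M : ℕ) [NeZero L] [NeZero M] :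
    (piProdZMod d L M).gen (Fin.last d) = (0, 1) :=
  prod_gen_natAdd (pi d L) (zmod M) 0

/-- Spatial coordinates of the space–time chart. [folklore] -/
@[simp] theorem piProdZMod_cval_castSucc (d L M : ℕ) [NeZero L] [NeZero M] (i : Fin d)
    (x : (Fin d → ZMod L) × ZMod M) : (piProdZMod d L M).cval (Fin.castSucc i) x = (x.1 i).val :=
  prod_cval_castAdd _ _ i x

/-- Temporal coordinate of the space–time chart. [folklore] -/
@[simp] theorem piProdZMod_cval_last (d L M : ℕ) [NeZero L] [NeZero M] (x : (Fin d → ZMod L) × ZMod M) :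
    (piProdZMod d L M).cval (Fin.last d) x = x.2.val :=
  prod_cval_natAdd (pi d L) (zmod M) 0 x

/-- **The time–space chart** of `ZMod L₀ × (Fin d → ZMod L)` (temporal direction first; the site type of the
finite-temperature lattice gauge theory files). [folklore] -/
def zmodProdPi (L₀ d L : ℕ) [NeZero L₀] [NeZero L] : TorusChart (ZMod L₀ × (Fin d → ZMod L)) (1 + d) :=
  (zmod L₀).prod (pi d L)

end Charts


end TorusChart

end Literature.MathematicalPhysics.QuantumFieldTheory
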